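import Literature.Computability.Complexity.OracleEmptyFP
import Literature.Computability.Complexity.OracleQueryMap
import Literature.Computability.Complexity.OracleComposition
import HarnessLib

/-!
# Running an oracle algorithm as a subroutine with self-answered queries is an `FP` string function

Topic `Literature/Computability/Complexity`; companion of `OracleEmptyFP.lean` (`FP^h ⊆ FP` for
`h ∈ FP`) and `OracleQueryMap.lean` (`mapQuery`, `comap`, `capQ`, `clock`). The standard reduction
step "on input `w`, run the (oracle) adversary `M` on the instance `pre w`, answering each of its
queries `q` by the polynomial-time rule `ans ⟨w, q⟩`, and read off its output" (Goldreich 2004,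
proofs of Prop. 6.4.5, 6.4.15, 6.4.31: an inverter / collision finder / one-time forger that emulates
a forger and answers its signing queries itself) is packaged once, in the transcript model:

* `OracleAlg.simAlg M pre c R` — the emulation as ONE oracle algorithm for the FIXED oracle `ans`:
  `M` run on `pre w` (`comap`), each query `q` rewritten to the record `⟨w, q⟩` (`mapQuery` with
  `simTag`, so that the fixed oracle `ans` sees the outer input), queries capped at
  `2|w| + 2 + c(|w|)` (`capQ`) and the whole clocked at `R(|w|)` rounds (`clock`);
* `OracleAlg.simFn M pre ans c R w` — its output within `R(|w|) + 1` rounds (always defined);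
* **`OracleAlg.simFn_mem_FP`** — `simFn ∈ FP` for `M` polynomial-time and `pre, ans ∈ FP`
  (`FP^{ans} ⊆ FP`, `FPRel_subset_FP_of_mem_FP`);
* **`OracleAlg.simFn_eq_of_run`** — SEMANTICS: if the genuine run of `M` on `pre w` against the
  `w`-dependent oracle `q ↦ ans ⟨w, q⟩` outputs `b` within `R(|w|)` rounds, asking only queries of
  length `≤ c(|w|)`, then `simFn … w = b`;
* the pair-output form for adversaries of the signature games (`OracleAlg (List Bool × List Bool)`,
  outputs coded by `pairBool`): `OracleAlg.simPairFn`, `simPairFn_mem_FP`, `simPairFn_eq_of_run`.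

## References

* S. Arora, B. Barak, *Computational Complexity: A Modern Approach*, CUP 2009, §3.4 (oracle
  machines; Example 3.6 (2)), §1.4.1 (clocked simulation).
* O. Goldreich, *Foundations of Cryptography II: Basic Applications*, CUP 2004, §6.4.1.2 (proof of
  Prop. 6.4.5: "`A'` invokes `A` on input `v`, and tries to answer its query"), as the consumer shape.
-/

namespace Literature.Computability.Complexity

open _root_.Computability Polynomial Brick

namespace OracleAlg

variable {β : Type}

/-! ### The emulating oracle algorithm -/

/-- The query rewriting of the emulation: `⟨w, ⟨listBool as, q⟩⟩ ↦ ⟨w, q⟩` (the outer input travels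
with the query; the transcript is dropped). [folklore] -/
noncomputable def simTag : List Bool → List Bool := fanoutFn fstF (sndPow 1)

/-- `simTag ⟨w, ⟨A, q⟩⟩ = ⟨w, q⟩`. [folklore] -/
@[simp] theorem simTag_apply (w A q : List Bool) : simTag (boolPair w (boolPair A q)) = boolPair w q := by
  simp [simTag]

/-- `simTag ∈ FP`. [folklore] -/
theorem simTag_mem_FP : simTag ∈ FP := fanoutFn_mem_FP fstF_mem_FP (sndPow_mem_FP 1)

/-- **The emulation as one oracle algorithm** (for the fixed oracle `ans`): run `M` on `pre w`, tag
each query with `w`, cap the tagged queries at `2|w| + 2 + c(|w|)`, clock at `R(|w|)` rounds.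
[Arora–Barak 2009, §3.4 Example 3.6 (2), §1.4.1] [cite: AroraBarak2009, §3.4 Example 3.6 (2)] -/
noncomputable def simAlg (M : OracleAlg (List Bool)) (pre : List Bool → List Bool) (c R : Polynomial ℕ) :
    OracleAlg (List Bool) :=
  ((((M.comap pre).mapQuery simTag).capQ (2 * X + 2 + c) []).clock R [])

/-- **The emulated output** `simFn M pre ans c R w`: the output of `simAlg` against `ans` within
`R(|w|) + 1` rounds (the clock guarantees one; `[]` is never reached). [folklore] -/
noncomputable def simFn (M : OracleAlg (List Bool)) (pre ans : List Bool → List Bool) (c R : Polynomial ℕ)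
    (w : List Bool) : List Bool :=
  ((simAlg M pre c R).run ans (R.eval w.length + 1) w).getD []

/-- The emulation is a polynomial-time oracle algorithm. [Arora–Barak 2009, §3.4 with §1.3]
[cite: AroraBarak2009, §3.4] -/
theorem isPolyTime_simAlg {M : OracleAlg (List Bool)} (hM : M.IsPolyTime (encodingList Bool))
    {pre : List Bool → List Bool} (hpre : pre ∈ FP) (c R : Polynomial ℕ) :
    (simAlg M pre c R).IsPolyTime (encodingList Bool) :=
  isPolyTime_clock (encodingList Bool)
    (isPolyTime_capQ (encodingList Bool)
      (isPolyTime_mapQuery (encodingList Bool) (isPolyTime_comap (encodingList Bool) hM hpre) simTag_mem_FP) _ _) _ _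

/-- The clocked emulation outputs within `R(|w|) + 1` rounds. [folklore] -/
theorem run_simAlg_eq_some (M : OracleAlg (List Bool)) (pre ans : List Bool → List Bool) (c R : Polynomial ℕ)
    (w : List Bool) {n : ℕ} (hn : R.eval w.length < n) :
    (simAlg M pre c R).run ans n w = some (simFn M pre ans c R w) := by
  have h1 := run_clock_isSome (((M.comap pre).mapQuery simTag).capQ (2 * X + 2 + c) []) R [] ans w
    (Nat.lt_succ_self (R.eval w.length))
  obtain ⟨b, hb⟩ := Option.isSome_iff_exists.1 h1
  have hdef : simFn M pre ans c R w = b := by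
    rw [simFn, simAlg, hb]; rfl
  rw [hdef]
  rcases le_total (R.eval w.length + 1) n with h | h
  · exact run_mono _ ans w h hb
  · obtain ⟨b', hb'⟩ := Option.isSome_iff_exists.1
      (run_clock_isSome (((M.comap pre).mapQuery simTag).capQ (2 * X + 2 + c) []) R [] ans w hn)
    have := run_mono _ ans w h hb'
    rw [simAlg]
    rw [hb, Option.some.injEq] at this
    rw [hb', this]

/-- **`simFn ∈ FP`** for `M` polynomial-time and `pre, ans ∈ FP`: `simFn ∈ FP^{ans} ⊆ FP`.
[Arora–Barak 2009, §3.4 Example 3.6 (2)] [cite: AroraBarak2009, §3.4 Example 3.6 (2)] -/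
theorem simFn_mem_FP {M : OracleAlg (List Bool)} (hM : M.IsPolyTime (encodingList Bool))
    {pre ans : List Bool → List Bool} (hpre : pre ∈ FP) (hans : ans ∈ FP) (c R : Polynomial ℕ) :
    simFn M pre ans c R ∈ FP := by
  refine FPRel_subset_FP_of_mem_FP hans ⟨simAlg M pre c R, isPolyTime_simAlg hM hpre c R,
    R + 1 + (2 * X + 2 + c), fun w => ⟨?_, fun y hy => ?_⟩⟩
  · exact run_simAlg_eq_some M pre ans c R w (by simp; omega)
  · have h := length_le_of_mem_queries_capQ _ (2 * X + 2 + c) [] ans w _ (queries_clock_subset _ R [] ans w _ hy)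
    simp only [eval_add, eval_mul, eval_ofNat, eval_X, eval_one] at h ⊢
    omega

/-- **Semantics of the emulation**: if the genuine run of `M` on `pre w` against the oracle
`q ↦ ans ⟨w, q⟩` outputs `b` within `R(|w|)` rounds and asks only queries of length `≤ c(|w|)`,
then `simFn M pre ans c R w = b`. [Arora–Barak 2009, §3.4; Goldreich 2004, §6.4.1.2 (the emulated
attack)] [cite: AroraBarak2009, §3.4 Example 3.6 (2)] -/
theorem simFn_eq_of_run {M : OracleAlg (List Bool)} {pre ans : List Bool → List Bool} {c R : Polynomial ℕ}
    {w b : List Bool} (hrun : M.run (fun q => ans (boolPair w q)) (R.eval w.length) (pre w) = some b)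
    (hq : ∀ q ∈ M.queries (fun q => ans (boolPair w q)) (R.eval w.length) (pre w), q.length ≤ c.eval w.length) :
    simFn M pre ans c R w = b := by
  -- the tagged queries are answered by `ans` exactly as the genuine ones are by `q ↦ ans ⟨w, q⟩`
  have hagree : MapAgree (M.comap pre) simTag ans (fun q => ans (boolPair w q)) w := by
    intro i q _ _
    rw [simTag_apply]
  have hmq : ((M.comap pre).mapQuery simTag).run ans (R.eval w.length) w = some b := by
    rw [run_mapQuery _ _ ans _ w hagree]
    show (M.comap pre).runAux _ w (R.eval w.length) [] = some b
    rw [runAux_comap]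
    exact hrun
  have hcapq : ∀ y ∈ ((M.comap pre).mapQuery simTag).queries ans (R.eval w.length) w,
      y.length ≤ (2 * X + 2 + c).eval w.length := by
    intro y hy
    obtain ⟨i, q, -, -, hqm, hyq⟩ := queries_mapQuery _ _ ans _ w hagree _ hy
    have hqm' : q ∈ M.queries (fun q => ans (boolPair w q)) (R.eval w.length) (pre w) := by
      have h := queriesAux_comap M pre (fun q => ans (boolPair w q)) w (R.eval w.length) []
      unfold queries at hqm ⊢
      rwa [h] at hqm
    have hlen := hq q hqm'
    rw [hyq, simTag_apply, length_boolPair]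
    simp only [eval_add, eval_mul, eval_ofNat, eval_X]
    omega
  have hcap : (((M.comap pre).mapQuery simTag).capQ (2 * X + 2 + c) []).run ans (R.eval w.length) w = some b := by
    rw [(run_capQ _ _ [] ans w _ hcapq).1, hmq]
  have hclk := run_clock_of_run _ R [] ans w hcap (le_refl _)
  have h := run_simAlg_eq_some M pre ans c R w (Nat.lt_succ_self _)
  have h' : (simAlg M pre c R).run ans (R.eval w.length + 1) w = some b :=
    run_mono _ ans w (Nat.le_succ _) hclk
  rw [h', Option.some.injEq] at h
  exact h.symm

/-! ### Pair-output adversaries (the forgers of the signature games) -/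

/-- The emulated output of a pair-output algorithm, as the pair code `⟨m, σ⟩` (outputs re-presented by
`mapOut`). [folklore] -/
noncomputable def simPairFn (M : OracleAlg (List Bool × List Bool)) (pre ans : List Bool → List Bool)
    (c R : Polynomial ℕ) : List Bool → List Bool :=
  simFn (M.mapOut fun p => boolPair p.1 p.2) pre ans c R

/-- **`simPairFn ∈ FP`** for `M` polynomial-time (outputs coded by `pairBool`) and `pre, ans ∈ FP`.
[Arora–Barak 2009, §3.4 Example 3.6 (2)] [cite: AroraBarak2009, §3.4 Example 3.6 (2)] -/
theorem simPairFn_mem_FP {M : OracleAlg (List Bool × List Bool)}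
    (hM : M.IsPolyTime ((encodingList Bool).pairBool (encodingList Bool)))
    {pre ans : List Bool → List Bool} (hpre : pre ∈ FP) (hans : ans ∈ FP) (c R : Polynomial ℕ) :
    simPairFn M pre ans c R ∈ FP :=
  simFn_mem_FP (hM.mapOut _ fun _ => rfl) hpre hans c R

/-- **Semantics, pair form**: if the genuine run outputs `(m, σ)` within `R(|w|)` rounds with queries of
length `≤ c(|w|)`, then `simPairFn … w = ⟨m, σ⟩`. [cite: AroraBarak2009, §3.4 Example 3.6 (2)] -/
theorem simPairFn_eq_of_run {M : OracleAlg (List Bool × List Bool)} {pre ans : List Bool → List Bool}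
    {c R : Polynomial ℕ} {w : List Bool} {b : List Bool × List Bool}
    (hrun : M.run (fun q => ans (boolPair w q)) (R.eval w.length) (pre w) = some b)
    (hq : ∀ q ∈ M.queries (fun q => ans (boolPair w q)) (R.eval w.length) (pre w), q.length ≤ c.eval w.length) :
    simPairFn M pre ans c R w = boolPair b.1 b.2 := by
  refine simFn_eq_of_run ?_ ?_
  · rw [run, runAux_mapOut, ← run, hrun]; rfl
  · intro q hq'
    rw [queries, queriesAux_mapOut] at hq'
    exact hq q hq'

end OracleAlg

end Literature.Computability.Complexity
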